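import Summits.AnomalousDissipation.AnomalousDissipation.Theorems.MarginalStabilityChainStrainedLayerLawClockEnstrophyClockExactTools
import Summits.AnomalousDissipation.AnomalousDissipation.Theorems.MarginalStabilityChainStrainedLayerLawClockNegMassAntitone
import HarnessLib

/-!
# Crux `MarginalStabilityChain.StrainedLayerLaw` (stmt-AnomalousDissipation-3007), line `FirstLemmasR2K4`
# (log-enstrophy clock + Nash roundness): the exact total-enstrophy clock

Support file (`--supports stmt-AnomalousDissipation-3007`; registered sub-goal `enstrophy_clock_exact` of line
`FirstLemmasR2K4`, lead c7, wave 2).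

What it proves: for every classical solution `(u, v, p)` of the stretched two-dimensional Navier–Stokes layer class
`IsStretchedLayerNSSolutionOn (Ioi 0) ν 1 1 L u v p` (`ν, L > 0`) with uniform exponential shear tails on every compact
time interval `[a, b] ⊂ (0, ∞)`, with `Ω(τ) = ∫_{(0,L]}∫_ℝ ω(τ)²` the total enstrophy and `P(τ) = ∫_{(0,L]}∫_ℝ |∇ω(τ)|²`
the palinstrophy of one period strip (`ω = ∂ₓv − ∂_yu`):

* (i) the IDENTITY `Ω(t) − Ω(s) = ∫_s^t (Ω − 2νP)` for `0 < s ≤ t` (the enstrophy balance of the class with stretching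
  rate `1`; proved in the tools file `…ClockEnstrophyClockExactTools` as the registered sub-goal
  `enstrophyClock_identity`: tools B–E of the clock line for `F(r) = r²`, cutoff `ψ_{1/ε}`, `ε → 0⁺`);
* (ii) the KINEMATIC ENSTROPHY FLOOR `Ω(t) · ∫∫|y||ω(t)| ≥ L²/16` for every `t > 0` (`ν`-free): the circulation per
  period is `−L` (`stub_circulationFloor` with `negMassLaw_negMass_eq` give `L ≤ ∫∫|ω|`), and pointwise
  `|ω| ≤ κ|y||ω| + λω²/2 + e^{−κ|y|}/(2λ)` (`1 − e^{−s} ≤ s`, `2λ|ω|φ ≤ λ²ω² + φ²`, `φ² ≤ φ`), `∫∫e^{−κ|y|} = 2L/κ`;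
  the choice `κ = L/(4M)`, `λ = 8M/L` (`M = ∫∫|y||ω|`) gives `L/4 ≤ 4MΩ/L`;
* (iii) the EXACT CLOCK MEAN LAW `|(T − 1) − ∫_1^T 2νP/Ω| ≤ K` for `T ≥ 1`: by (i) and the continuity of `Ω − 2νP` on
  `(0, ∞)` (dominated convergence) `Ω′ = Ω − 2νP`, `Ω > 0` by (ii), so `(log Ω)′ = 1 − 2νP/Ω` and
  `∫_1^T (1 − 2νP/Ω) = log Ω(T) − log Ω(1)` (pattern `clock_log_identity`); `log Ω(T)` is bounded for `T ≥ 1` by the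
  fixed-`ν` a-priori bounds `Ω ≤ B`, `∫∫|y||ω| ≤ M` (`stub_vorticityUniformBounds`) and (ii) (`Ω ≥ L²/(16M)`).

All `[folklore]` (enstrophy balance of 2-D Navier–Stokes: Majda–Bertozzi 2002, §1.4 and §3.1.1, for the stretched
class; Ben-Artzi, Arch. Rational Mech. Anal. 128 (1994)).
-/

-- `Summit.<Summit>.<Problem>` is the tree's mandated summit-side namespace (CONVENTIONS §2); for this
-- single-conjunct summit the two coincide, so the duplicate is deliberate.
set_option linter.dupNamespace false

noncomputable section

open scoped Topology ENNReal
open Filter Set Function MeasureTheory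

namespace Summit.AnomalousDissipation.AnomalousDissipation.Theorems.StrainedLayerLaw.LogEnstrophyClock

open Literature.Analysis.FluidPDE Literature.Analysis.FluidPDE.StretchedLayer
open Summit.AnomalousDissipation.AnomalousDissipation.Theses.MarginalStabilityChain
open Summit.AnomalousDissipation.AnomalousDissipation.Theorems.StrainedLayerLaw.StrainWorkSumRule

/-! ## The kinematic enstrophy floor `Ω · ∫∫|y||ω| ≥ L²/16` -/

section Floor

/-- `∫∫_{(0,L]×ℝ} e^{−k|y|} = 2L/k` (`L ≥ 0`, `k > 0`). [folklore] -/
theorem enstrophyClock_integral_weight {L k : ℝ} (hL : 0 ≤ L) (hk : 0 < k) :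
    ∫ q in Ioc 0 L ×ˢ univ, Real.exp (-k * |q.2|) = 2 * L / k := by
  rw [volume_restrict_strip, integral_fun_snd (fun y : ℝ => Real.exp (-k * |y|)), measureReal_restrict_apply_univ,
    Real.volume_real_Ioc_of_le hL, sub_zero, smul_eq_mul,
    integral_comp_abs (f := fun y : ℝ => Real.exp (-k * y)), integral_exp_mul_Ioi (neg_lt_zero.2 hk) 0,
    mul_zero, Real.exp_zero, neg_div_neg_eq]
  ring

/-- The pointwise splitting behind the floor: for `κ, λ > 0` and reals `w, y`,
`|w| ≤ κ|y||w| + λw²/2 + e^{−κ|y|}/(2λ)` (`|w| = |w|(1 − φ) + |w|φ` with `φ = e^{−κ|y|}`, `1 − φ ≤ κ|y|`,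
`2λ|w|φ ≤ λ²w² + φ²`, `φ² ≤ φ`). [folklore] -/
theorem enstrophyClock_abs_le_split {κ lam : ℝ} (hκ : 0 < κ) (hlam : 0 < lam) (w y : ℝ) :
    |w| ≤ κ * (|y| * |w|) + lam / 2 * w ^ 2 + Real.exp (-κ * |y|) / (2 * lam) := by
  have hφ0 : 0 < Real.exp (-κ * |y|) := Real.exp_pos _
  have hφ1 : Real.exp (-κ * |y|) ≤ 1 := Real.exp_le_one_iff.2 (by nlinarith [abs_nonneg y])
  have h1 : 1 - Real.exp (-κ * |y|) ≤ κ * |y| := by linarith [Real.add_one_le_exp (-κ * |y|)]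
  have h2 : |w| * Real.exp (-κ * |y|) ≤ lam / 2 * w ^ 2 + Real.exp (-κ * |y|) ^ 2 / (2 * lam) := by
    rw [show lam / 2 * w ^ 2 + Real.exp (-κ * |y|) ^ 2 / (2 * lam) =
      ((lam * |w|) ^ 2 + Real.exp (-κ * |y|) ^ 2) / (2 * lam) by rw [mul_pow, sq_abs]; field_simp,
      le_div_iff₀ (by positivity)]
    nlinarith [sq_nonneg (lam * |w| - Real.exp (-κ * |y|))]
  have h3 : Real.exp (-κ * |y|) ^ 2 / (2 * lam) ≤ Real.exp (-κ * |y|) / (2 * lam) :=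
    div_le_div_of_nonneg_right (by nlinarith) (by positivity)
  have h4 : |w| * (1 - Real.exp (-κ * |y|)) ≤ κ * (|y| * |w|) := by
    calc |w| * (1 - Real.exp (-κ * |y|)) ≤ |w| * (κ * |y|) := mul_le_mul_of_nonneg_left h1 (abs_nonneg w)
      _ = κ * (|y| * |w|) := by ring
  calc |w| = |w| * (1 - Real.exp (-κ * |y|)) + |w| * Real.exp (-κ * |y|) := by ring
    _ ≤ _ := by linarith

/-- The real-variable end of the floor: if `L > 0`, `Ω, M ≥ 0` and `L ≤ κM + λΩ/2 + L/(κλ)` for all `κ, λ > 0`, then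
`L²/16 ≤ ΩM` (`M > 0`: `κ = L/(4M)`, `λ = 8M/L`; `M = 0` is impossible: `λ = L/(Ω + 1)`, `κ = 4/λ`). [folklore] -/
theorem enstrophyClock_floor_real {L Ω M : ℝ} (hL : 0 < L) (hΩ : 0 ≤ Ω) (hM : 0 ≤ M)
    (h : ∀ κ lam : ℝ, 0 < κ → 0 < lam → L ≤ κ * M + lam / 2 * Ω + L / (κ * lam)) :
    L ^ 2 / 16 ≤ Ω * M := by
  rcases hM.eq_or_lt with hM0 | hMpos
  · exfalso
    have hΩ1 : 0 < Ω + 1 := by linarith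
    have hlam : 0 < L / (Ω + 1) := div_pos hL hΩ1
    have h1 := h (4 / (L / (Ω + 1))) (L / (Ω + 1)) (by positivity) hlam
    rw [← hM0, mul_zero, zero_add] at h1
    have e1 : L / (4 / (L / (Ω + 1)) * (L / (Ω + 1))) = L / 4 := by
      rw [div_mul_cancel₀ _ hlam.ne']
    have e2 : L / (Ω + 1) / 2 * Ω < L / 2 := by
      rw [div_div, div_mul_eq_mul_div, div_lt_div_iff₀ (by positivity) two_pos]
      nlinarith
    rw [e1] at h1
    linarith
  · have h1 := h (L / (4 * M)) (8 * M / L) (by positivity) (by positivity)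
    have e1 : L / (4 * M) * M = L / 4 := by field_simp
    have e2 : 8 * M / L / 2 * Ω = 4 * M * Ω / L := by ring
    have e3 : L / (L / (4 * M) * (8 * M / L)) = L / 2 := by field_simp; norm_num
    rw [e1, e2, e3] at h1
    have h2 : L / 4 ≤ 4 * M * Ω / L := by linarith
    rw [le_div_iff₀ hL] at h2
    nlinarith

/-- **The kinematic enstrophy floor for one slice.** For a `C²` slice `(u, v)`, `L`-periodic in `x` (`L > 0`), with the
shear far field `u → ±½` and shear tails `SliceTails C k u v` (`k > 0`):
`L²/16 ≤ (∫_{(0,L]}∫_ℝ ω²) · ∫_{(0,L]}∫_ℝ |y||ω|`. The circulation of one period cell is `−L`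
(`stub_circulationFloor`, `negMassLaw_negMass_eq`: `L ≤ ∫∫|ω|`); integrating the pointwise splitting
`enstrophyClock_abs_le_split` over the strip (`∫∫e^{−κ|y|} = 2L/κ`) gives `L ≤ κM + λΩ/2 + L/(κλ)` for all
`κ, λ > 0`, and `enstrophyClock_floor_real` concludes. No dynamics and no `ν`. [folklore] -/
theorem enstrophyClock_kinematic_floor {L C k : ℝ} {f g : ℝ → ℝ → ℝ} (hL : 0 < L) (hk : 0 < k)
    (hf : ContDiff ℝ 2 (fun q : ℝ × ℝ => f q.1 q.2)) (hg : ContDiff ℝ 2 (fun q : ℝ × ℝ => g q.1 q.2))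
    (hpu : ∀ x y, f (x + L) y = f x y) (hpv : ∀ x y, g (x + L) y = g x y)
    (hut : ∀ x, Tendsto (fun y => f x y) atTop (𝓝 (1 / 2)))
    (hub : ∀ x, Tendsto (fun y => f x y) atBot (𝓝 (-(1 / 2)))) (hT : SliceTails C k f g) :
    L ^ 2 / 16 ≤ (∫ x in Ioc 0 L, ∫ y, vorticity f g x y ^ 2) * ∫ x in Ioc 0 L, ∫ y, |y| * |vorticity f g x y| := by
  have hC : 0 ≤ C := hT.nonneg
  have cω : Continuous fun q : ℝ × ℝ => vorticity f g q.1 q.2 := (contDiff_one_vorticity hf hg).continuous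
  have hω : ∀ x y, |vorticity f g x y| ≤ C * Real.exp (-k * |y|) := tails_abs_vorticity_le hT
  have hS : MeasurableSet (Ioc (0:ℝ) L ×ˢ (univ : Set ℝ)) := measurableSet_Ioc.prod MeasurableSet.univ
  -- integrability on the strip of `|ω|`, `ω²`, `|y||ω|`
  have iA : IntegrableOn (fun q : ℝ × ℝ => |vorticity f g q.1 q.2|) (Ioc 0 L ×ˢ univ) :=
    integrableOn_strip_of_abs_le_exp cω.abs hC hk fun x _ y => by rw [abs_abs]; exact hω x y
  have iΩ : IntegrableOn (fun q : ℝ × ℝ => vorticity f g q.1 q.2 ^ 2) (Ioc 0 L ×ˢ univ) :=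
    enstrophyCeiling_integrableOn_sq hk hT hf hg
  have iM : IntegrableOn (fun q : ℝ × ℝ => |q.2| * |vorticity f g q.1 q.2|) (Ioc 0 L ×ˢ univ) := by
    refine integrableOn_strip_of_abs_le_sq_exp (C := C) (continuous_snd.abs.mul cω.abs) hk fun x _ y => ?_
    rw [abs_mul, abs_abs, abs_abs]
    calc |y| * |vorticity f g x y| ≤ |y| * (C * Real.exp (-k * |y|)) :=
          mul_le_mul_of_nonneg_left (hω x y) (abs_nonneg y)
      _ = C * (|y| * Real.exp (-k * |y|)) := by ring
      _ ≤ C * ((1 + |y|) ^ 2 * Real.exp (-k * |y|)) :=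
          mul_le_mul_of_nonneg_left (abs_mul_exp_le_one_add_abs_sq_mul_exp k y) hC
  -- the strip forms
  set Ω : ℝ := ∫ q in Ioc 0 L ×ˢ univ, vorticity f g q.1 q.2 ^ 2 with hΩ
  set M : ℝ := ∫ q in Ioc 0 L ×ˢ univ, |q.2| * |vorticity f g q.1 q.2| with hM
  set A : ℝ := ∫ q in Ioc 0 L ×ˢ univ, |vorticity f g q.1 q.2| with hA
  have eΩ : (∫ x in Ioc 0 L, ∫ y, vorticity f g x y ^ 2) = Ω := integral_iterated_eq_strip iΩ
  have eM : (∫ x in Ioc 0 L, ∫ y, |y| * |vorticity f g x y|) = M := integral_iterated_eq_strip iM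
  have eA : (∫ x in Ioc 0 L, ∫ y, |vorticity f g x y|) = A := integral_iterated_eq_strip iA
  have hΩ0 : 0 ≤ Ω := setIntegral_nonneg hS fun q _ => sq_nonneg _
  have hM0 : 0 ≤ M := setIntegral_nonneg hS fun q _ => by positivity
  -- the circulation of one period cell: `L ≤ ∫∫|ω|`
  have hLA : L ≤ A := by
    have h1 := stub_circulationFloor L C k hL hk f g hf hg hpu hpv hut hub hT
    rw [negMassLaw_negMass_eq hL hk hf hg hpv hut hub hT, eA] at h1
    linarith
  -- the split inequality, integrated over the strip
  have hsplit : ∀ κ lam : ℝ, 0 < κ → 0 < lam → L ≤ κ * M + lam / 2 * Ω + L / (κ * lam) := by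
    intro κ lam hκ hlam
    have ik := kato_integrableOn_weight hκ L
    have i1 : Integrable (fun q : ℝ × ℝ => κ * (|q.2| * |vorticity f g q.1 q.2|) + lam / 2 * vorticity f g q.1 q.2 ^ 2)
        (volume.restrict (Ioc 0 L ×ˢ univ)) := (iM.const_mul κ).add (iΩ.const_mul (lam / 2))
    have i2 : Integrable (fun q : ℝ × ℝ => Real.exp (-κ * |q.2|) / (2 * lam)) (volume.restrict (Ioc 0 L ×ˢ univ)) :=
      ik.div_const (2 * lam)
    have h1 : A ≤ κ * M + lam / 2 * Ω + 2 * L / κ / (2 * lam) := by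
      have h : A ≤ ∫ q in Ioc 0 L ×ˢ univ, (κ * (|q.2| * |vorticity f g q.1 q.2|) + lam / 2 * vorticity f g q.1 q.2 ^ 2 +
          Real.exp (-κ * |q.2|) / (2 * lam)) :=
        integral_mono iA (i1.add i2) fun q => enstrophyClock_abs_le_split hκ hlam (vorticity f g q.1 q.2) q.2
      rw [integral_add i1 i2, integral_add (iM.const_mul κ) (iΩ.const_mul (lam / 2)), integral_const_mul,
        integral_const_mul, integral_div, enstrophyClock_integral_weight hL.le hκ] at h
      exact h
    have e : 2 * L / κ / (2 * lam) = L / (κ * lam) := by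
      field_simp
    rw [e] at h1
    exact hLA.trans h1
  rw [eΩ, eM]
  exact enstrophyClock_floor_real hL hΩ0 hM0 hsplit

end Floor

/-! ## Regularity of `Ω`: continuity of `Ω − 2νP`, the enstrophy law `Ω′ = Ω − 2νP`, positivity, the log identity -/

section Regularity

variable {ν L : ℝ} {u v p : ℝ → ℝ → ℝ → ℝ}

/-- **Continuity of `t ↦ Ω(t) − 2νP(t)` on `(0, ∞)`** along a classical solution with shear tails on compact time
intervals (dominated convergence on the strip: `ω`, `∇ω` are jointly continuous in `(t, x, y)`, `ω² ≤ C²e^{−k|y|}`,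
`|∇ω|² ≤ 2C²e^{−k|y|}` locally uniformly in time; Fubini). [folklore] -/
theorem enstrophyClock_continuousOn (hsol : IsStretchedLayerNSSolutionOn (Ioi 0) ν 1 1 L u v p)
    (htails : ∀ a b : ℝ, 0 < a → a < b → ExpTails (Icc a b) u v) :
    ContinuousOn (fun τ => (∫ x in Ioc 0 L, ∫ y, vorticity (u τ) (v τ) x y ^ 2) -
      2 * ν * ∫ x in Ioc 0 L, ∫ y, (dX (vorticity (u τ) (v τ)) x y ^ 2 + dY (vorticity (u τ) (v τ)) x y ^ 2))
      (Ioi 0) := by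
  intro t₀ ht₀
  have ht₀' : 0 < t₀ := ht₀
  refine ContinuousAt.continuousWithinAt ?_
  obtain ⟨C, k, hk, hCk⟩ := htails (t₀ / 2) (t₀ + 1) (by positivity) (by linarith)
  have hI : t₀ ∈ Ioo (t₀ / 2) (t₀ + 1) := ⟨by linarith, by linarith⟩
  have hST : ∀ τ ∈ Ioo (t₀ / 2) (t₀ + 1), SliceTails C k (u τ) (v τ) := fun τ hτ => (hCk τ ⟨hτ.1.le, hτ.2.le⟩).1
  have hpos : ∀ {τ : ℝ}, τ ∈ Ioo (t₀ / 2) (t₀ + 1) → 0 < τ := fun hτ => lt_trans (by positivity) hτ.1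
  have hu2 : ∀ {τ : ℝ}, 0 < τ → ContDiff ℝ 2 (fun q : ℝ × ℝ => u τ q.1 q.2) := fun hτ => hsol.contDiff_u (mem_Ioi.2 hτ)
  have hv2 : ∀ {τ : ℝ}, 0 < τ → ContDiff ℝ 2 (fun q : ℝ × ℝ => v τ q.1 q.2) := fun hτ => hsol.contDiff_v (mem_Ioi.2 hτ)
  have hdiv : ∀ {τ : ℝ}, 0 < τ → ∀ x y, dX (u τ) x y + dY (v τ) x y = 0 := fun hτ => hsol.divFree _ (mem_Ioi.2 hτ)
  have hW := kato_continuousOn_vorticity_spacetime hsol.contDiffOn_u hsol.contDiffOn_v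
  have hX := clock_continuousOn_dX_vorticity_spacetime hsol.contDiffOn_u hsol.contDiffOn_v
  have hY := clock_continuousOn_dY_vorticity_spacetime hsol.contDiffOn_u hsol.contDiffOn_v
  have hω1 : ∀ {τ : ℝ}, 0 < τ → ContDiff ℝ 1 (fun q : ℝ × ℝ => vorticity (u τ) (v τ) q.1 q.2) := fun hτ =>
    contDiff_one_vorticity (hu2 hτ) (hv2 hτ)
  -- `Ω` in strip form is continuous at `t₀`
  have hΩ : ContinuousAt (fun τ => ∫ q in Ioc 0 L ×ˢ univ, vorticity (u τ) (v τ) q.1 q.2 ^ 2) t₀ := by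
    refine continuousAt_of_dominated (μ := volume.restrict (Ioc 0 L ×ˢ univ))
      (bound := fun q => C ^ 2 * Real.exp (-k * |q.2|)) ?_ ?_ ?_ ?_
    · filter_upwards [Ioo_mem_nhds hI.1 hI.2] with τ hτ
      exact ((hω1 (hpos hτ)).continuous.pow 2).aestronglyMeasurable
    · filter_upwards [Ioo_mem_nhds hI.1 hI.2] with τ hτ
      refine Eventually.of_forall fun q => ?_
      rw [Real.norm_eq_abs, abs_of_nonneg (sq_nonneg _)]
      exact clock_vorticity_sq_le hk (hST τ hτ) q.1 q.2
    · exact (kato_integrableOn_weight hk L).const_mul _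
    · exact Eventually.of_forall fun q => (clock_continuousAt_time hW ht₀' q).pow 2
  -- `P` in strip form is continuous at `t₀`
  have hP : ContinuousAt (fun τ => ∫ q in Ioc 0 L ×ˢ univ,
      (dX (vorticity (u τ) (v τ)) q.1 q.2 ^ 2 + dY (vorticity (u τ) (v τ)) q.1 q.2 ^ 2)) t₀ := by
    refine continuousAt_of_dominated (μ := volume.restrict (Ioc 0 L ×ˢ univ))
      (bound := fun q => 2 * C ^ 2 * Real.exp (-k * |q.2|)) ?_ ?_ ?_ ?_
    · filter_upwards [Ioo_mem_nhds hI.1 hI.2] with τ hτ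
      exact (((continuous_dX (hω1 (hpos hτ))).pow 2).add
        ((continuous_dY (hω1 (hpos hτ))).pow 2)).aestronglyMeasurable
    · filter_upwards [Ioo_mem_nhds hI.1 hI.2] with τ hτ
      refine Eventually.of_forall fun q => ?_
      rw [Real.norm_eq_abs, abs_of_nonneg (by positivity)]
      exact clock_grad_vorticity_sq_le hk (hST τ hτ) (hu2 (hpos hτ)) (hv2 (hpos hτ)) (hdiv (hpos hτ)) q.1 q.2
    · exact (kato_integrableOn_weight hk L).const_mul _
    · exact Eventually.of_forall fun q =>
        ((clock_continuousAt_time hX ht₀' q).pow 2).add ((clock_continuousAt_time hY ht₀' q).pow 2)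
  -- combine and return to the iterated functionals
  have hstrip := hΩ.sub (hP.const_mul (2 * ν))
  refine hstrip.congr_of_eventuallyEq ?_
  filter_upwards [Ioo_mem_nhds hI.1 hI.2] with τ hτ
  have e1 : (∫ x in Ioc 0 L, ∫ y, vorticity (u τ) (v τ) x y ^ 2) =
      ∫ q in Ioc 0 L ×ˢ univ, vorticity (u τ) (v τ) q.1 q.2 ^ 2 :=
    integral_iterated_eq_strip (enstrophyCeiling_integrableOn_sq hk (hST τ hτ) (hu2 (hpos hτ)) (hv2 (hpos hτ)))
  have e2 : (∫ x in Ioc 0 L, ∫ y, (dX (vorticity (u τ) (v τ)) x y ^ 2 + dY (vorticity (u τ) (v τ)) x y ^ 2)) =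
      ∫ q in Ioc 0 L ×ˢ univ, (dX (vorticity (u τ) (v τ)) q.1 q.2 ^ 2 + dY (vorticity (u τ) (v τ)) q.1 q.2 ^ 2) :=
    integral_iterated_eq_strip (enstrophyClock_integrableOn_gradSq hk (hST τ hτ) (hu2 (hpos hτ)) (hv2 (hpos hτ))
      (hdiv (hpos hτ)))
  rw [e1, e2]
  rfl

/-- **The total-enstrophy law `Ω′(t) = Ω(t) − 2νP(t)`** (`t > 0`): the integral identity `enstrophyClock_identity` on
`[t/2, t′]`, the continuity `enstrophyClock_continuousOn`, and the fundamental theorem of calculus. [folklore] -/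
theorem enstrophyClock_hasDerivAt (hν : 0 < ν) (hL : 0 < L) (hsol : IsStretchedLayerNSSolutionOn (Ioi 0) ν 1 1 L u v p)
    (htails : ∀ a b : ℝ, 0 < a → a < b → ExpTails (Icc a b) u v) {t : ℝ} (ht : 0 < t) :
    HasDerivAt (fun τ => ∫ x in Ioc 0 L, ∫ y, vorticity (u τ) (v τ) x y ^ 2)
      ((∫ x in Ioc 0 L, ∫ y, vorticity (u t) (v t) x y ^ 2) -
        2 * ν * ∫ x in Ioc 0 L, ∫ y, (dX (vorticity (u t) (v t)) x y ^ 2 + dY (vorticity (u t) (v t)) x y ^ 2)) t := by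
  set g : ℝ → ℝ := fun τ => (∫ x in Ioc 0 L, ∫ y, vorticity (u τ) (v τ) x y ^ 2) -
    2 * ν * ∫ x in Ioc 0 L, ∫ y, (dX (vorticity (u τ) (v τ)) x y ^ 2 + dY (vorticity (u τ) (v τ)) x y ^ 2) with hg
  have hgc : ContinuousOn g (Ioi 0) := enstrophyClock_continuousOn hsol htails
  have ht2 : 0 < t / 2 := by positivity
  have hsub : uIcc (t / 2) t ⊆ Ioi 0 := fun τ hτ => by rw [uIcc_of_le (by linarith)] at hτ; exact ht2.trans_le hτ.1
  have hint : IntervalIntegrable g volume (t / 2) t := (hgc.mono hsub).intervalIntegrable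
  have hmeas : StronglyMeasurableAtFilter g (𝓝 t) volume := ContinuousOn.stronglyMeasurableAtFilter isOpen_Ioi hgc t ht
  have hcont : ContinuousAt g t := hgc.continuousAt (Ioi_mem_nhds ht)
  have h1 : HasDerivAt (fun t' => ∫ τ in (t / 2)..t', g τ) (g t) t :=
    intervalIntegral.integral_hasDerivAt_right hint hmeas hcont
  have h2 : HasDerivAt (fun t' => (∫ x in Ioc 0 L, ∫ y, vorticity (u (t / 2)) (v (t / 2)) x y ^ 2) +
      ∫ τ in (t / 2)..t', g τ) (g t) t := h1.const_add _
  refine h2.congr_of_eventuallyEq ?_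
  filter_upwards [Ioi_mem_nhds (show t / 2 < t by linarith)] with t' ht'
  have hid := enstrophyClock_identity ν L hν hL u v p hsol htails (t / 2) t' ht2 (le_of_lt ht')
  simp only [hg]
  linarith

/-- **Positivity of the total enstrophy** along a tailed solution (`t > 0`): `Ω(t) ≥ 0`, and `Ω(t) = 0` would contradict
the kinematic floor `Ω · ∫∫|y||ω| ≥ L²/16 > 0`. [folklore] -/
theorem enstrophyClock_pos (hL : 0 < L) (hsol : IsStretchedLayerNSSolutionOn (Ioi 0) ν 1 1 L u v p)
    (htails : ∀ a b : ℝ, 0 < a → a < b → ExpTails (Icc a b) u v) {t : ℝ} (ht : 0 < t) :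
    0 < ∫ x in Ioc 0 L, ∫ y, vorticity (u t) (v t) x y ^ 2 := by
  obtain ⟨C, k, hk, hCk⟩ := htails (t / 2) (t + 1) (by positivity) (by linarith)
  have hT : SliceTails C k (u t) (v t) := (hCk t ⟨by linarith, by linarith⟩).1
  have ht' : t ∈ Ioi (0:ℝ) := ht
  have hfloor := enstrophyClock_kinematic_floor hL hk (hsol.contDiff_u ht') (hsol.contDiff_v ht')
    (hsol.periodic_u t ht') (hsol.periodic_v t ht') (hsol.tendsto_u_atTop t ht') (hsol.tendsto_u_atBot t ht') hT
  have h0 : 0 ≤ ∫ x in Ioc 0 L, ∫ y, vorticity (u t) (v t) x y ^ 2 :=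
    integral_nonneg fun x => integral_nonneg fun y => sq_nonneg _
  rcases h0.eq_or_lt with h | h
  · rw [← h, zero_mul] at hfloor
    linarith [(by positivity : (0:ℝ) < L ^ 2 / 16)]
  · exact h

/-- **The exact log-enstrophy clock identity for the TOTAL enstrophy.** Along a tailed classical solution, for
`0 < t₁ ≤ T`: `log Ω(T) − log Ω(t₁) = (T − t₁) − ∫_{t₁}^T 2νP/Ω` (`(log Ω)′ = (Ω − 2νP)/Ω = 1 − 2νP/Ω` by
`enstrophyClock_hasDerivAt` and `Ω > 0`, continuity of the integrand on `(0, ∞)`, fundamental theorem of calculus;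
pattern `clock_log_identity`). [folklore] -/
theorem enstrophyClock_log_identity (hν : 0 < ν) (hL : 0 < L)
    (hsol : IsStretchedLayerNSSolutionOn (Ioi 0) ν 1 1 L u v p)
    (htails : ∀ a b : ℝ, 0 < a → a < b → ExpTails (Icc a b) u v) {t₁ T : ℝ} (ht₁ : 0 < t₁) (hT : t₁ ≤ T) :
    Real.log (∫ x in Ioc 0 L, ∫ y, vorticity (u T) (v T) x y ^ 2) -
        Real.log (∫ x in Ioc 0 L, ∫ y, vorticity (u t₁) (v t₁) x y ^ 2) =
      (T - t₁) - ∫ t in t₁..T, 2 * ν * (∫ x in Ioc 0 L, ∫ y, (dX (vorticity (u t) (v t)) x y ^ 2 +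
        dY (vorticity (u t) (v t)) x y ^ 2)) / (∫ x in Ioc 0 L, ∫ y, vorticity (u t) (v t) x y ^ 2) := by
  set Ω : ℝ → ℝ := fun t => ∫ x in Ioc 0 L, ∫ y, vorticity (u t) (v t) x y ^ 2 with hΩ
  set P : ℝ → ℝ := fun t => ∫ x in Ioc 0 L, ∫ y, (dX (vorticity (u t) (v t)) x y ^ 2 +
    dY (vorticity (u t) (v t)) x y ^ 2) with hP
  have hderiv : ∀ t, 0 < t → HasDerivAt Ω (Ω t - 2 * ν * P t) t := fun t ht =>
    enstrophyClock_hasDerivAt hν hL hsol htails ht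
  have hpos : ∀ t, 0 < t → 0 < Ω t := fun t ht => enstrophyClock_pos hL hsol htails ht
  -- the derivative of `log Ω` and its continuity on `(0, ∞)`
  have hlog : ∀ t, 0 < t → HasDerivAt (fun s => Real.log (Ω s)) ((Ω t - 2 * ν * P t) / Ω t) t :=
    fun t ht => (hderiv t ht).log (hpos t ht).ne'
  have hgc : ContinuousOn (fun t => Ω t - 2 * ν * P t) (Ioi 0) := enstrophyClock_continuousOn hsol htails
  have hΩc : ContinuousOn Ω (Ioi 0) := fun t ht => (hderiv t ht).continuousAt.continuousWithinAt
  have hqc : ContinuousOn (fun t => (Ω t - 2 * ν * P t) / Ω t) (Ioi 0) := hgc.div hΩc fun t ht => (hpos t ht).ne'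
  have hsub : uIcc t₁ T ⊆ Ioi 0 := fun t ht => by rw [uIcc_of_le hT] at ht; exact ht₁.trans_le ht.1
  have hint : IntervalIntegrable (fun t => (Ω t - 2 * ν * P t) / Ω t) volume t₁ T :=
    (hqc.mono hsub).intervalIntegrable
  have hftc := intervalIntegral.integral_eq_sub_of_hasDerivAt (fun t ht => hlog t (hsub ht)) hint
  -- split the integrand `(Ω − 2νP)/Ω = 1 − 2νP/Ω`
  have hPc : ContinuousOn (fun t => 2 * ν * P t / Ω t) (Ioi 0) := by
    have h2 : ContinuousOn (fun t => 2 * ν * P t) (Ioi 0) := by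
      refine (hΩc.sub hgc).congr fun t _ => ?_
      show 2 * ν * P t = Ω t - (Ω t - 2 * ν * P t)
      ring
    exact h2.div hΩc fun t ht => (hpos t ht).ne'
  have hint2 : IntervalIntegrable (fun t => 2 * ν * P t / Ω t) volume t₁ T := (hPc.mono hsub).intervalIntegrable
  have hsplit : ∫ t in t₁..T, (Ω t - 2 * ν * P t) / Ω t = (T - t₁) - ∫ t in t₁..T, 2 * ν * P t / Ω t := by
    have hcongr : ∫ t in t₁..T, (Ω t - 2 * ν * P t) / Ω t = ∫ t in t₁..T, ((1 : ℝ) - 2 * ν * P t / Ω t) := by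
      apply intervalIntegral.integral_congr
      intro t ht
      have hΩt : Ω t ≠ 0 := (hpos t (hsub ht)).ne'
      show (Ω t - 2 * ν * P t) / Ω t = 1 - 2 * ν * P t / Ω t
      field_simp
    rw [hcongr, intervalIntegral.integral_sub intervalIntegrable_const hint2, intervalIntegral.integral_const,
      smul_eq_mul, mul_one]
  rw [← hftc, hsplit]

end Regularity

/-! ## The registered sub-goal -/

section Main

/-- **The exact total-enstrophy clock (registered sub-goal `enstrophy_clock_exact` of line `FirstLemmasR2K4`).** For
every classical solution of the stretched two-dimensional Navier–Stokes layer class on `(0, ∞)` (`ν, L > 0`) with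
uniform exponential shear tails on compact time intervals, with `Ω = ∫_{(0,L]}∫_ℝ ω²` and `P = ∫_{(0,L]}∫_ℝ |∇ω|²`:
(i) `Ω(t) − Ω(s) = ∫_s^t (Ω − 2νP)` for `0 < s ≤ t` (`enstrophyClock_identity`); (ii) the kinematic floor
`L²/16 ≤ Ω(t) · ∫∫|y||ω(t)|` for `t > 0` (`enstrophyClock_kinematic_floor`: circulation `−L` per period and the
pointwise splitting); (iii) the exact clock mean law `|(T − 1) − ∫_1^T 2νP/Ω| ≤ K` for `T ≥ 1`
(`enstrophyClock_log_identity`: the left side is `|log Ω(T) − log Ω(1)|`, and `L²/(16M) ≤ Ω(T) ≤ B` for `T ≥ 1` by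
(ii) and the fixed-`ν` a-priori bounds `stub_vorticityUniformBounds`). [folklore] -/
theorem enstrophy_clock_exact : ∀ (ν L : ℝ), 0 < ν → 0 < L → ∀ (u v p : ℝ → ℝ → ℝ → ℝ), IsStretchedLayerNSSolutionOn (Ioi 0) ν 1 1 L u v p → (∀ a b : ℝ, 0 < a → a < b → ExpTails (Icc a b) u v) → (∀ s t : ℝ, 0 < s → s ≤ t → (∫ x in Ioc 0 L, ∫ y, vorticity (u t) (v t) x y ^ 2) - (∫ x in Ioc 0 L, ∫ y, vorticity (u s) (v s) x y ^ 2) = ∫ τ in s..t, ((∫ x in Ioc 0 L, ∫ y, vorticity (u τ) (v τ) x y ^ 2) - 2 * ν * ∫ x in Ioc 0 L, ∫ y, (dX (vorticity (u τ) (v τ)) x y ^ 2 + dY (vorticity (u τ) (v τ)) x y ^ 2))) ∧ (∀ t : ℝ, 0 < t → L ^ 2 / 16 ≤ (∫ x in Ioc 0 L, ∫ y, vorticity (u t) (v t) x y ^ 2) * ∫ x in Ioc 0 L, ∫ y, |y| * |vorticity (u t) (v t) x y|) ∧ ∃ K : ℝ, ∀ T : ℝ, 1 ≤ T → |(T - 1)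 - ∫ τ in (1:ℝ)..T, 2 * ν * (∫ x in Ioc 0 L, ∫ y, (dX (vorticity (u τ) (v τ)) x y ^ 2 + dY (vorticity (u τ) (v τ)) x y ^ 2)) / (∫ x in Ioc 0 L, ∫ y, vorticity (u τ) (v τ) x y ^ 2)| ≤ K := by
  intro ν L hν hL u v p hsol htails
  -- (ii) the kinematic floor at every instant
  have hii : ∀ t : ℝ, 0 < t → L ^ 2 / 16 ≤ (∫ x in Ioc 0 L, ∫ y, vorticity (u t) (v t) x y ^ 2) *
      ∫ x in Ioc 0 L, ∫ y, |y| * |vorticity (u t) (v t) x y| := by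
    intro t ht
    obtain ⟨C, k, hk, hCk⟩ := htails (t / 2) (t + 1) (by positivity) (by linarith)
    have hT : SliceTails C k (u t) (v t) := (hCk t ⟨by linarith, by linarith⟩).1
    have ht' : t ∈ Ioi (0:ℝ) := ht
    exact enstrophyClock_kinematic_floor hL hk (hsol.contDiff_u ht') (hsol.contDiff_v ht') (hsol.periodic_u t ht')
      (hsol.periodic_v t ht') (hsol.tendsto_u_atTop t ht') (hsol.tendsto_u_atBot t ht') hT
  refine ⟨enstrophyClock_identity ν L hν hL u v p hsol htails, hii, ?_⟩
  -- (iii) the exact clock mean law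
  obtain ⟨_, B, M, hABM⟩ := stub_vorticityUniformBounds ν L hν hL u v p hsol htails
  set Ω : ℝ → ℝ := fun t => ∫ x in Ioc 0 L, ∫ y, vorticity (u t) (v t) x y ^ 2 with hΩ
  set P : ℝ → ℝ := fun t => ∫ x in Ioc 0 L, ∫ y, (dX (vorticity (u t) (v t)) x y ^ 2 +
    dY (vorticity (u t) (v t)) x y ^ 2) with hP
  have hpos : ∀ t, 0 < t → 0 < Ω t := fun t ht => enstrophyClock_pos hL hsol htails ht
  have hMpos : 0 < M := by
    have h1 : L ^ 2 / 16 ≤ Ω 1 * ∫ x in Ioc 0 L, ∫ y, |y| * |vorticity (u 1) (v 1) x y| := hii 1 one_pos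
    have h2 := (hABM 1 le_rfl).2.2
    have h3 : 0 < Ω 1 * ∫ x in Ioc 0 L, ∫ y, |y| * |vorticity (u 1) (v 1) x y| := lt_of_lt_of_le (by positivity) h1
    have h4 := (pos_iff_pos_of_mul_pos h3).1 (hpos 1 one_pos)
    linarith
  have hlow : ∀ T, 1 ≤ T → L ^ 2 / (16 * M) ≤ Ω T := by
    intro T hT1
    have hT0 : 0 < T := one_pos.trans_le hT1
    have h1 : L ^ 2 / 16 ≤ Ω T * ∫ x in Ioc 0 L, ∫ y, |y| * |vorticity (u T) (v T) x y| := hii T hT0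
    have h3 : L ^ 2 / 16 ≤ Ω T * M := h1.trans (mul_le_mul_of_nonneg_left (hABM T hT1).2.2 (hpos T hT0).le)
    rw [div_le_iff₀ (by positivity)]
    linarith
  have hup : ∀ T, 1 ≤ T → Ω T ≤ B := fun T hT1 => (hABM T hT1).2.1
  refine ⟨|Real.log (L ^ 2 / (16 * M))| + |Real.log B| + |Real.log (Ω 1)|, fun T hT1 => ?_⟩
  have hT0 : 0 < T := one_pos.trans_le hT1
  have hid := enstrophyClock_log_identity hν hL hsol htails one_pos hT1
  have hl1 : Real.log (L ^ 2 / (16 * M)) ≤ Real.log (Ω T) := Real.log_le_log (by positivity) (hlow T hT1)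
  have hl2 : Real.log (Ω T) ≤ Real.log B := Real.log_le_log (hpos T hT0) (hup T hT1)
  have hlT : |Real.log (Ω T)| ≤ |Real.log (L ^ 2 / (16 * M))| + |Real.log B| :=
    (abs_le_max_abs_abs hl1 hl2).trans (max_le_add_of_nonneg (abs_nonneg _) (abs_nonneg _))
  show |(T - 1) - ∫ τ in (1:ℝ)..T, 2 * ν * P τ / Ω τ| ≤ _
  rw [← hid]
  calc |Real.log (Ω T) - Real.log (Ω 1)| ≤ |Real.log (Ω T)| + |Real.log (Ω 1)| := abs_sub _ _
    _ ≤ _ := by linarith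

end Main

end Summit.AnomalousDissipation.AnomalousDissipation.Theorems.StrainedLayerLaw.LogEnstrophyClock

end
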